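import Literature.IUT.HodgeArakelov.MonoThetaFromGroupsProp13Genuine
import Literature.IUT.HodgeArakelov.MonoThetaFromGroupsProofsTate
import Literature.AnabelianGeometry.EtaleTheta.Discharge.Sec5Lem59ivNode
import Literature.AnabelianGeometry.EtaleTheta.Discharge.Sec2RigidRowsAtModelTateInr

/-!
# [IUTchII] Prop. 1.2 (ii) / 1.3 (i): the `ofEnvIsoBiTheta_*` closers RE-CLOSED at the GENUINE [EtTh] §5 data of the
# Tate setting — F-0545 `EnvIsoBiTheta` ([EtTh] Lemma 5.9 (iv)) SUPPLIED BY NAME (C-R33 / K4)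

S. Mochizuki, *Inter-universal Teichmüller theory II*, kurims manuscript (Dec. 2020), §1, Prop. 1.2 (ii) pp. 25–26,
Prop. 1.3 (i) p. 26 ([IUTchII] Prop 1.2 (ii) / Prop 1.3 (i), kurims pp.25-26) [claim: Mochizuki2012, status: disputed]
(D-0012 claim key; the series is DISPUTED; nothing printed is asserted here); S. Mochizuki, *The étale theta function …*
[EtTh], Publ. RIMS 45 (2009), §5 Lemma 5.9 (iv) p. 332, §2 Cor. 2.18 (ii)/(iv) p. 60 (refereed; inputs BY NAME).

abc-iut cell, sub-cell L-K/R-C (D-0079), seat abc-iut-w4-d042 gen 8, row «K4-RECLOSE IUTchII:Prop1.3(i) F-0545 SITE»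
(CLAIM 2026-08-27T02:2xZ).  RULING C-R33 (abc-iut-plan g9): a cone node whose closing theorem binds a FACT-LIST row of class
«refuted-closure» is discharged VACUOUSLY-AS-TYPED until re-closed against the row's surviving instance form.  abc-iut-c312-2's
`CONE-K4-RECLOSE.tsv` v4 (2026-08-27T01:38Z) lists node `IUTchII:Prop1.3(i)` as RECLOSABLE with 5/6 rows re-closed by
abc-iut-w4-d009's `K4ReclosedIUTchIIBiThetaFamily` (p465274); the ONE open site there (its evidence row 57, verdict NO-MATCH at
2026-08-26T19:54Z) is this seat's gen-2 closer `ofEnvIsoBiTheta_extCyc_eq_ker_toPiY` (`MonoThetaFromGroupsProp13Genuine`),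
which — besides the [EtTh] §5 schema rows F-0542 `SectionsFactor` (`h1`), F-0738 `SgpCapSection` (`hsec`), F-0543
`SgpCupSection` (`hcs`), F-0536 `ConstantsEqNormalizer` (`h8`) and the §2 row F-0635 `ThetaEnvData.Cor218_ii` (`h218ii`) —
binds [EtTh] Lemma 5.9 (iv) ITSELF, F-0545 `ThetaFrobenioid.EnvIsoBiTheta` (`h59iv`), whose closed producers were TOY-ONLY at
that time, and pins the rigidity datum to the level of the §5 data (`R : RigidData 𝔉.N l`).

SINCE THEN abc-iut-w6-d053 (gen 6) landed the GENUINE producer of F-0545 (`Discharge/Sec5Lem59ivNode`, cone node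
`EtTh:Lem5.9(iv)` → discharged p467740): `ThetaFrobenioid.envIsoBiTheta_ofThetaSettingYdd_of_originClause_canonical` —
Lemma 5.9 (iv) IN FULL at abc-iut-L2-t4's §5 data OF A THETA SETTING `𝔉 := ofThetaSettingData μ hC hS h Q R K' constEmb …` over
`BiKummerSetting.mkOfThetaSettingYdd C e μ hC hS tf hZ hP NH` (`Π^tp_X̲̲ := C.Huu`, `A_⊙^bs := Ÿ̲̲`), `T := C.thetaEnvData μ hC hS`,
`ι := id`, `DK := dkOfConnectedTemperoidData …` (the honest `K^×`-part), the five law proofs indexing `E^Π_N` SUPPLIED by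
`facts_ofThetaSettingYddData_of_constantsDictionary` ⟸ {`hconst`, `hD`} (abc-iut-L2-t4, p440765) and `outerActionLZ_of`,
residual EXACTLY {junction data, `hconst` (Def. 3.6 (iii)), the dictionary `hD` (Def. 3.6 (iii)/(iv)), a cyclotome reading
`m`, the Prop. 5.2 (iii) origin clause `hΘ`}.

THIS PROOF-ONLY FILE (no `def`, no Prop fact, no `instance`, no `sorry`; nothing landed is edited or restated) re-closes the
`ofEnvIsoBiTheta_*` family at THAT carrier, specialised to the theta setting OF RECORD at which the §2 rows are theorems — the
Tate instance `ThetaSetting.modelχq p 1 2` with abc-iut-w5-d171's étale-theta datum `etaleThetaDataχqInr p` (the §2 carrier of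
p465274): the rigidity datum is abc-iut-L2-t8's `C.rigidData μ hC hS (prop15iii_etaleThetaDataχqInr p hC) L`, whose
`toThetaEnvData` IS `C.thetaEnvData μ hC hS` (definitionally — this is what lets the level pin `R : RigidData 𝔉.N l` and
`ι := id` meet the producer), F-0635 is abc-iut-L2-t10/L2's `thetaEnvData_cor218_ii_of_H2` over the Prop. 1.5 (ii)/(iii)
THEOREMS `prop15ii_etaleThetaDataχqInr` / `prop15iii_etaleThetaDataχqInr` (structural 2-torsion condition `H2` on `μ`), and
F-0624 (for the Prop. 1.2 (i) indeterminacy clause) is `rigidData_cor218_iv_fibre_of_origin` with abc-iut-L2-t5's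
`ThetaSetting.modelχq_isEtThOrigin` / `hYcl_modelχq`.  Per closer:
* `ofEnvIsoBiTheta_env_toEtale_ofThetaSettingYdd_modelTate` — Prop. 1.2 (ii): the underlying [EtTh] datum of `M^Θ(𝒞)` built
  from Lemma 5.9 (iv) BY NAME is `E^Π_N` on the nose;
* `ofEnvIsoBiTheta_extCyc_eq_ker_toPiY_ofThetaSettingYdd_modelTate` — **the K4 site**: Prop. 1.3 (i) exterior clause
  `Π_μ(M^Θ(𝒞)) = Ker(E^Π_N ↠ Π^tp_Y̲)`; and `…_of_thetaSectionCompat` — the same with F-0521 displayed in its surviving INSTANCE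
  FORM (`η ∈ thetaCocycles`, `hcompat`) instead of the origin clause (w6-d053's second producer);
* `ofEnvIsoBiTheta_extCyc_eq_range_muIncl_ofThetaSettingYdd_modelTate` — Prop. 1.3 (i): `Π_μ(M^Θ(𝒞))` IS the image of
  `μ_N(B_N) ↪ E^Π_N` ("corresponds to the subgroup `μ_N(S) ⊆ O^×(S)`", `S := B_N`);
* `ofEnvIsoBiTheta_indeterminacy_ofThetaSettingYdd_modelTate` — Prop. 1.2 (i) indeterminacy clause for the Def. 1.1 (i) output.
Binders that REMAIN, all DATA or structural/dictionary hypotheses of the producers of record (none is a FACT-LIST row of class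
refuted-closure): the Ÿ̲̲-junction data (`tf`, `h`, `Q`, `R`, `K'`, `constEmb`, `hinvc`, `hinvp`), `hconst`, `hD`, `m`, `hΘ`
(resp. `η`, `hη`, `hcompat`), the cusp labels `L`, `H2`, `hC`/`hS` (F-2491 PROVED in tree `ThetaSetting.compat`; F-2511
vocabulary), the [IUTchII] §1 side data `X`, the `ModelFrame` `F` and the interface instance `Fr`.  Universes: `Type 0`.

HONEST FRAMING: re-closed-at-a-carrier ≠ proved-in-print; `modelχq` is a SEMI-SYNTHETIC Tate model of the typed [EtTh] §1
interface (abc-iut-f-153's label); `tf` (a tempered Frobenioid over `B^temp(Π^tp_X̲̲)⁰`) is an abstract parameter, not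
inhabited in the tree for an actual curve; whether the DATA binders are jointly inhabited at this carrier is not shown here
(not a K4 question); typed ≠ discharged; no side taken on [IUTchIII] Cor. 3.12 or on any author; nothing here asserts that abc
is proved or refuted. [claim: Mochizuki2012, status: disputed]
-/

noncomputable section

namespace Literature.IUT.HodgeArakelov

open CategoryTheory Opposite Literature.AlgebraicGeometry.Frobenioids Literature.AnabelianGeometry.SemiGraphs
  Literature.AnabelianGeometry.SemiGraphs.GaloisObjects
  Literature.AlgebraicGeometry.Frobenioids.QuasiTemperoid.BTempConnected
open Literature.AnabelianGeometry.EtaleTheta Literature.AnabelianGeometry.EtaleTheta.ThetaFrobenioid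
  Literature.AnabelianGeometry.EtaleTheta.SettingModel
open scoped Literature.AnabelianGeometry.EtaleTheta Pointwise

universe v₀

section EnvIsoBiThetaFamily

/-! ### The carrier: abc-iut-w6-d053's Ÿ̲̲-junction data (variable block of `Discharge/Sec5Lem59ivNode.lean`) over the theta
setting `ThetaSetting.modelχq p 1 2` with the étale-theta datum of record `etaleThetaDataχqInr p`, plus the §2-side data
(cusp labels `L`, the 2-torsion condition `H2`) and the [IUTchII] §1 data (`X`, `F`, `Fr`) of the closers -/
variable {p : ℕ} [Fact p.Prime] {l : ℕ} {C : (etaleThetaDataχqInr p).DoubleUnderline l}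
  {e : (ThetaSetting.modelχq p 1 2 even_two).toTemperedCurve.GroupLevelData} {N : ℕ+}
  (μ : (ThetaSetting.modelχq p 1 2 even_two).CyclotomeMod l N)
  (hC : (ThetaSetting.modelχq p 1 2 even_two).Compat) (hS : (ThetaSetting.modelχq p 1 2 even_two).Sec2Hyps)
  {D₀ : Type} [Category.{v₀} D₀] {V : FrdIMonoidStub.{0}} {T₀ : RealifiedDivisorMonoids (D₀ := D₀) V}
  {VD : FrdICatStub.{1, 0, 0} (ConnectedPart (BTemp (C.temperedArithmeticGroup e).Pi))}
  {tf : TemperedFrobenioid T₀ (ConnectedPart (BTemp (C.temperedArithmeticGroup e).Pi)) VD} {hZ : tf.monoidType = MonoidType.Z}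
  {hP : ∀ A : (ConnectedPart (BTemp (C.temperedArithmeticGroup e).Pi))ᵒᵖ, IsPerfect (tf.Φ.carrier A)}
  {NH : Subgroup (Field.absoluteGaloisGroup (ThetaSetting.modelχq p 1 2 even_two).K) → tf.category → ℕ+ → Prop}
  {pullFrac : ∀ {A A' : (BiKummerSetting.mkOfThetaSettingYdd C e μ hC hS tf hZ hP NH).C} (_ : A' ⟶ A),
    (BiKummerSetting.mkOfThetaSettingYdd C e μ hC hS tf hZ hP NH).biratUnits A →
      (BiKummerSetting.mkOfThetaSettingYdd C e μ hC hS tf hZ hP NH).biratUnits A'}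
  {θ : (BiKummerSetting.mkOfThetaSettingYdd C e μ hC hS tf hZ hP NH).biratUnits
    (BiKummerSetting.mkOfThetaSettingYdd C e μ hC hS tf hZ hP NH).Aodot}
  {Bl : (BiKummerSetting.mkOfThetaSettingYdd C e μ hC hS tf hZ hP NH).C}
  {Pl : (BiKummerSetting.mkOfThetaSettingYdd C e μ hC hS tf hZ hP NH).FractionPair θ Bl}
  {Rl : (BiKummerSetting.mkOfThetaSettingYdd C e μ hC hS tf hZ hP NH).NthRoot θ Pl C.lPNat pullFrac}
  (h : ModelFrobenioid.Hypotheses tf.divisorMonoid tf.ratFnFunctor)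
  (Q : FrobenioidTheta.ThetaSubquotientStub.{0} (ConnectedPart (BTemp (C.temperedArithmeticGroup e).Pi)))
  (R : (BiKummerSetting.mkOfThetaSettingYdd C e μ hC hS tf hZ hP NH).NthRoot Rl.root Rl.pair N pullFrac)
  (K' : Type) [Field K'] (constEmb : K'ˣ →* tf.biratUnitsModel R.BN) (constEmb_injective : Function.Injective constEmb)
  (hinvc : ∀ g : Aut R.AN.base,
    pull tf.divisorMonoid g.hom (ModelFrobenioid.div R.pair.num) = ModelFrobenioid.div R.pair.num)
  (hinvp : ∀ y : (C.thetaEnvData μ hC hS).PiX, y ∈ (C.thetaEnvData μ hC hS).PiYdd →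
    pull tf.divisorMonoid ((BiKummerSetting.mkOfThetaSettingYdd C e μ hC hS tf hZ hP NH).galoisSurj
      R.AN.base R.αData.isGalois ((ContinuousMulEquiv.refl _) y)).hom (ModelFrobenioid.div R.pair.den) = ModelFrobenioid.div R.pair.den)
  (hconst : ∀ (ε : Aut R.BN) (k : K'ˣ), tf.biratAutModel R.BN ε (constEmb k) = constEmb k)
  (m : (ofThetaSettingData μ hC hS h Q R K' constEmb constEmb_injective hinvc hinvp).muTorsion
      (ofThetaSettingData μ hC hS h Q R K' constEmb constEmb_injective hinvc hinvp).BN N ≃* (C.thetaEnvData μ hC hS).mu)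
  {Cst : Subgroup ((ofThetaSettingData μ hC hS h Q R K' constEmb constEmb_injective hinvc hinvp).biratUnits
      (ofThetaSettingData μ hC hS h Q R K' constEmb constEmb_injective hinvc hinvp).BN)}
  {ν' : Cst →* (PadicAlgCl p)ˣ}
  (hD : BiratAutAction.ConstantsDictionary
    (biratAutAction_ofConnectedTemperoidData (T := C.thetaEnvData μ hC hS) h Q C.odd_lPNat R (ContinuousMulEquiv.refl _) K' constEmb
      constEmb_injective hinvc hinvp hconst) C μ hC hS (ContinuousMulEquiv.refl _) m Cst ν')
  (L : C.CuspLabels)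
  (H2 : ∀ t : (ThetaSetting.modelχq p 1 2 even_two).lDeltaTheta l, t ^ 2 = 1 → μ.red t = 1)
  (X : ThetaSetting.SideData (C.rigidData μ hC hS (prop15iii_etaleThetaDataχqInr p hC) L).toThetaEnvData)
  (F : ModelFrame (ThetaSetting.ofThetaEnvData (C.rigidData μ hC hS (prop15iii_etaleThetaDataχqInr p hC) L).toThetaEnvData X)
    (C.rigidData μ hC hS (prop15iii_etaleThetaDataχqInr p hC) L))
  (Fr : TemperedFrobenioidData
    (ThetaSetting.ofThetaEnvData (C.rigidData μ hC hS (prop15iii_etaleThetaDataχqInr p hC) L).toThetaEnvData X))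

/-- **IUTchII:Prop1.3(i) RE-CLOSED (C-R33) at the F-0545 site, closer `ofEnvIsoBiTheta_extCyc_eq_ker_toPiY`**
(`Π_μ(M^Θ(𝒞)) = Ker(E^Π_N ↠ Π^tp_Y̲)` for the `M^Θ(𝒞) = E^Π_N` built from [EtTh] Lemma 5.9 (iv) BY NAME, [EtTh] Rmk. 5.10.3;
kurims II p. 26): F-0545 `EnvIsoBiTheta` SUPPLIED by abc-iut-w6-d053's genuine producer
`envIsoBiTheta_ofThetaSettingYdd_of_originClause_canonical` at the §5 data of the Tate setting (`A_⊙^bs := Ÿ̲̲`, `ι := id`, honest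
`DK`), the law proofs `h1`/`hsec`/`hcs`/`h8` (F-0542/F-0738/F-0543/F-0536) by `facts_ofThetaSettingYddData_of_constantsDictionary`
⟸ {`hconst`, `hD`} and `h3` by `outerActionLZ_of` (read off the producer's type), F-0635 by `thetaEnvData_cor218_ii_of_H2` over the
Prop. 1.5 (ii)/(iii) theorems of `etaleThetaDataχqInr p` (structural `H2`); residual = junction data, `hconst`, `hD`, `m`, the
Prop. 5.2 (iii) origin clause `hΘ`, `L`, `H2`, and the [IUTchII] §1 DATA `X`, `F`, `Fr`.
([IUTchII] Prop 1.3 (i), kurims p.26) [claim: Mochizuki2012, status: disputed] -/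
theorem ofEnvIsoBiTheta_extCyc_eq_ker_toPiY_ofThetaSettingYdd_modelTate
    (hΘ : (fun k : (C.thetaEnvData μ hC hS).PiYdd =>
        (m ((ofThetaSettingData μ hC hS h Q R K' constEmb constEmb_injective hinvc hinvp).diffCocycle
          (facts_ofThetaSettingYddData_of_constantsDictionary (hD' := hD)) k))⁻¹) ∈ C.thetaCocycles hC μ) :
    let 𝔉₅ := ofThetaSettingData μ hC hS h Q R K' constEmb constEmb_injective hinvc hinvp
    let h59 := envIsoBiTheta_ofThetaSettingYdd_of_originClause_canonical μ hC hS h Q R K' constEmb constEmb_injective hinvc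
      hinvp hconst m hD hΘ
    let h218 := C.thetaEnvData_cor218_ii_of_H2 μ hC hS (prop15iii_etaleThetaDataχqInr p hC)
      (prop15ii_etaleThetaDataχqInr p hC) H2
    (EnvOfFrobenioid.ofEnvIsoBiTheta 𝔉₅ _ _ _ _ _ _ X F h218 (ContinuousMulEquiv.refl _) h59 Fr).recon.extCyc =
      𝔉₅.toPiY.ker := by
  intro 𝔉₅ h59 h218
  exact ofEnvIsoBiTheta_extCyc_eq_ker_toPiY 𝔉₅ _ _ _ _ _ _ X F h218 _ h59 Fr

/-- **The same K4 site with F-0521 displayed in its surviving INSTANCE FORM** — the Prop. 5.2 (iii) dictionary `hcompat`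
(«the unit part of `s^⊔-Π_N(k)` read through `m` is `η(k)⁻¹`») for a cocycle `η` OF THE COLLECTION against the DERIVED `Facts` ⟸
{`hconst`, `hD`}, instead of the origin clause: abc-iut-w6-d053's second producer
`envIsoBiTheta_ofThetaSettingYdd_of_thetaSectionCompat_canonical` feeds the closer `ofEnvIsoBiTheta_extCyc_eq_ker_toPiY` at the
same carrier.  ([IUTchII] Prop 1.3 (i), kurims p.26) [claim: Mochizuki2012, status: disputed] -/
theorem ofEnvIsoBiTheta_extCyc_eq_ker_toPiY_ofThetaSettingYdd_modelTate_of_thetaSectionCompat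
    {η : (C.thetaEnvData μ hC hS).PiYdd → (C.thetaEnvData μ hC hS).mu} (hη : η ∈ (C.thetaEnvData μ hC hS).thetaCocycles)
    (hcompat : (ofThetaSettingData μ hC hS h Q R K' constEmb constEmb_injective hinvc hinvp).ThetaSectionCompat
      (facts_ofThetaSettingYddData_of_constantsDictionary (hD' := hD)) (C.thetaEnvData μ hC hS)
      (ContinuousMulEquiv.refl _).toMulEquiv m
      (identifiesPiYdd_ofThetaSettingData' μ hC hS h Q R K' constEmb constEmb_injective hinvc hinvp) η) :
    let 𝔉₅ := ofThetaSettingData μ hC hS h Q R K' constEmb constEmb_injective hinvc hinvp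
    let h59 := envIsoBiTheta_ofThetaSettingYdd_of_thetaSectionCompat_canonical μ hC hS h Q R K' constEmb constEmb_injective
      hinvc hinvp hconst m hD hη hcompat
    let h218 := C.thetaEnvData_cor218_ii_of_H2 μ hC hS (prop15iii_etaleThetaDataχqInr p hC)
      (prop15ii_etaleThetaDataχqInr p hC) H2
    (EnvOfFrobenioid.ofEnvIsoBiTheta 𝔉₅ _ _ _ _ _ _ X F h218 (ContinuousMulEquiv.refl _) h59 Fr).recon.extCyc =
      𝔉₅.toPiY.ker := by
  intro 𝔉₅ h59 h218
  exact ofEnvIsoBiTheta_extCyc_eq_ker_toPiY 𝔉₅ _ _ _ _ _ _ X F h218 _ h59 Fr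

/-- **IUTchII:Prop1.3(i) RE-CLOSED (C-R33), closer `ofEnvIsoBiTheta_extCyc_eq_range_muIncl`** («the exterior cyclotome
`Π_μ(M^Θ(𝒞))` corresponds to the subgroup `μ_N(S) ⊆ O^×(S) ⊆ Aut(S)`», `S := B_N`: `Π_μ(M^Θ(𝒞))` IS the image of
`μ_N(B_N) ↪ E^Π_N`, `u ↦ (u, 1)`; kurims II p. 26) at the same carrier, F-0545 by the genuine producer, every other FACT binder by
the producers named above.  ([IUTchII] Prop 1.3 (i), kurims p.26) [claim: Mochizuki2012, status: disputed] -/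
theorem ofEnvIsoBiTheta_extCyc_eq_range_muIncl_ofThetaSettingYdd_modelTate
    (hΘ : (fun k : (C.thetaEnvData μ hC hS).PiYdd =>
        (m ((ofThetaSettingData μ hC hS h Q R K' constEmb constEmb_injective hinvc hinvp).diffCocycle
          (facts_ofThetaSettingYddData_of_constantsDictionary (hD' := hD)) k))⁻¹) ∈ C.thetaCocycles hC μ) :
    let 𝔉₅ := ofThetaSettingData μ hC hS h Q R K' constEmb constEmb_injective hinvc hinvp
    let h59 := envIsoBiTheta_ofThetaSettingYdd_of_originClause_canonical μ hC hS h Q R K' constEmb constEmb_injective hinvc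
      hinvp hconst m hD hΘ
    let h218 := C.thetaEnvData_cor218_ii_of_H2 μ hC hS (prop15iii_etaleThetaDataχqInr p hC)
      (prop15ii_etaleThetaDataχqInr p hC) H2
    (EnvOfFrobenioid.ofEnvIsoBiTheta 𝔉₅ _ _ _ _ _ _ X F h218 (ContinuousMulEquiv.refl _) h59 Fr).recon.extCyc =
      𝔉₅.muIncl.range := by
  intro 𝔉₅ h59 h218
  exact ofEnvIsoBiTheta_extCyc_eq_range_muIncl 𝔉₅ _ _ _ _ _ _ X F h218 _ h59 Fr

/-- **IUTchII:Prop1.2(ii) RE-CLOSED (C-R33), closer `ofEnvIsoBiTheta_env_toEtale`** («`M^Θ(𝒞)` — the Prop. 1.2 (ii) output built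
from [EtTh] Lemma 5.9 (iv) BY NAME — has underlying [EtTh] datum EXACTLY `E^Π_N`», kurims II pp. 25–26) at the same carrier,
F-0545 by the genuine producer, every other FACT binder by the producers named above.
([IUTchII] Prop 1.2 (ii), kurims pp.25-26) [claim: Mochizuki2012, status: disputed] -/
theorem ofEnvIsoBiTheta_env_toEtale_ofThetaSettingYdd_modelTate
    (hΘ : (fun k : (C.thetaEnvData μ hC hS).PiYdd =>
        (m ((ofThetaSettingData μ hC hS h Q R K' constEmb constEmb_injective hinvc hinvp).diffCocycle
          (facts_ofThetaSettingYddData_of_constantsDictionary (hD' := hD)) k))⁻¹) ∈ C.thetaCocycles hC μ) :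
    let 𝔉₅ := ofThetaSettingData μ hC hS h Q R K' constEmb constEmb_injective hinvc hinvp
    let hf := facts_ofThetaSettingYddData_of_constantsDictionary (hD' := hD)
    let h59 := envIsoBiTheta_ofThetaSettingYdd_of_originClause_canonical μ hC hS h Q R K' constEmb constEmb_injective hinvc
      hinvp hconst m hD hΘ
    let h218 := C.thetaEnvData_cor218_ii_of_H2 μ hC hS (prop15iii_etaleThetaDataχqInr p hC)
      (prop15ii_etaleThetaDataχqInr p hC) H2
    (EnvOfFrobenioid.ofEnvIsoBiTheta 𝔉₅ _ _ _ _ _ _ X F h218 (ContinuousMulEquiv.refl _) h59 Fr).env.toEtale =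
      𝔉₅.frdMonoThetaEnv hf.sectionsFactor 𝔉₅.outerActionLZ_of hf.sgpCapSection hf.sgpCupSection hf.constantsEqNormalizer
        (dkOfConnectedTemperoidData (T := C.thetaEnvData μ hC hS) h Q C.odd_lPNat R (ContinuousMulEquiv.refl _) K' constEmb
          constEmb_injective hinvc hinvp hconst
          (kxRootNModCyclotome_ofThetaSettingData_of_constantsDictionary μ hC hS h Q R K' constEmb constEmb_injective hinvc
            hinvp hconst m hD)) := by
  intro 𝔉₅ hf h59 h218
  exact ofEnvIsoBiTheta_env_toEtale 𝔉₅ _ _ _ _ _ _ X F h218 _ h59 Fr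

/-- **IUTchII:Prop1.2(i)/(ii) RE-CLOSED (C-R33), closer `ofEnvIsoBiTheta_indeterminacy`** («the Def. 1.1 (i) output of
`M^Θ(𝒞)` has the Prop. 1.2 (i) isomorphism indeterminacy — a group of `μ_N`-conjugacy classes of automorphisms of order `1`
(resp. `2`) if `N` is odd (resp. even)», kurims II p. 25) at the same carrier: F-0545 by the genuine producer, F-0624
`RigidData.Cor218_iv_fibre` by `rigidData_cor218_iv_fibre_of_origin` over abc-iut-L2-t5's `ThetaSetting.modelχq_isEtThOrigin` /
`hYcl_modelχq`, every other FACT binder by the producers named above.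
([IUTchII] Prop 1.2 (i), kurims p.25) [claim: Mochizuki2012, status: disputed] -/
theorem ofEnvIsoBiTheta_indeterminacy_ofThetaSettingYdd_modelTate
    (hΘ : (fun k : (C.thetaEnvData μ hC hS).PiYdd =>
        (m ((ofThetaSettingData μ hC hS h Q R K' constEmb constEmb_injective hinvc hinvp).diffCocycle
          (facts_ofThetaSettingYddData_of_constantsDictionary (hD' := hD)) k))⁻¹) ∈ C.thetaCocycles hC μ) :
    let 𝔉₅ := ofThetaSettingData μ hC hS h Q R K' constEmb constEmb_injective hinvc hinvp
    let h59 := envIsoBiTheta_ofThetaSettingYdd_of_originClause_canonical μ hC hS h Q R K' constEmb constEmb_injective hinvc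
      hinvp hconst m hD hΘ
    let h218 := C.thetaEnvData_cor218_ii_of_H2 μ hC hS (prop15iii_etaleThetaDataχqInr p hC)
      (prop15ii_etaleThetaDataχqInr p hC) H2
    Prop12_i_indeterminacy
      (EnvOfFrobenioid.ofEnvIsoBiTheta 𝔉₅ _ _ _ _ _ _ X F h218 (ContinuousMulEquiv.refl _) h59 Fr).recon := by
  intro 𝔉₅ h59 h218
  exact ofEnvIsoBiTheta_indeterminacy 𝔉₅ _ _ _ _ _ _ X F h218 _ h59 Fr
    (C.rigidData_cor218_iv_fibre_of_origin μ hC hS (prop15iii_etaleThetaDataχqInr p hC) L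
      (ThetaSetting.modelχq_isEtThOrigin p 1 2 even_two) (hYcl_modelχq p 1 2 even_two))

/-- **IUTchII:Prop1.3(i)–(ii) RE-CLOSED (C-R33), closer `prop13_i_ii_ofEnvIsoBiTheta`** (abc-iut-L6-t1's `Prop13_i_ii` for the
genuine `M^Θ(𝒞)` from Lemma 5.9 (iv) BY NAME over the interface instance `TemperedFrobenioidData.ofThetaFrobenioid`, kurims II
p. 26) at the same carrier: F-0545 by the genuine producer, the other FACT binders by the producers named above; the [AbsTopIII]
comparison DATA `ψ`, `i₁` (Cor. 1.10 (c)), `i₂` (Rmk. 3.2.1), `c₁`, `c₂`, the base equivalence `eB` and the subquotient record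
`Pj` (abc-iut-L2-t4's v1 `ThetaSubquotientProj`, whose inhabitation at a given carrier is a separate question — cf.
abc-iut-L2-t9's p476337 / abc-iut-w6-d079's v2 record p481568) stay binders (not FACT rows; the value-identification residual
G-w4d042-1 belongs to Prop. 1.3 (iii)).  ([IUTchII] Prop 1.3 (i)(ii), kurims p.26) [claim: Mochizuki2012, status: disputed] -/
theorem prop13_i_ii_ofEnvIsoBiTheta_ofThetaSettingYdd_modelTate
    (hΘ : (fun k : (C.thetaEnvData μ hC hS).PiYdd =>
        (m ((ofThetaSettingData μ hC hS h Q R K' constEmb constEmb_injective hinvc hinvp).diffCocycle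
          (facts_ofThetaSettingYddData_of_constantsDictionary (hD' := hD)) k))⁻¹) ∈ C.thetaCocycles hC μ) :
    let 𝔉₅ := ofThetaSettingData μ hC hS h Q R K' constEmb constEmb_injective hinvc hinvp
    let h59 := envIsoBiTheta_ofThetaSettingYdd_of_originClause_canonical μ hC hS h Q R K' constEmb constEmb_injective hinvc
      hinvp hconst m hD hΘ
    let h218 := C.thetaEnvData_cor218_ii_of_H2 μ hC hS (prop15iii_etaleThetaDataχqInr p hC)
      (prop15ii_etaleThetaDataχqInr p hC) H2
    ∀ (eB : ConnectedPart (BTemp (C.temperedArithmeticGroup e).Pi) ≌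
        BTemp0 (ThetaSetting.ofThetaEnvData (C.rigidData μ hC hS (prop15iii_etaleThetaDataχqInr p hC) L).toThetaEnvData X).PiX)
      (Pj : FrobenioidCyclotomicRigidity.ThetaSubquotientProj 𝔉₅)
      (ψ : ModPow (ModelCyclotomes.intCyc (C.rigidData μ hC hS (prop15iii_etaleThetaDataχqInr p hC) L)).carrier
        (𝔉₅.N : ℕ) ≃* 𝔉₅.lDeltaModN 𝔉₅.BN)
      {MTM Gc PX : Type} [Group MTM] [Group Gc] [Group PX]
      (i₁ : Gc ≃* PX) (i₂ : MTM ≃* Gc) (c₁ : 𝔉₅.muTorsion 𝔉₅.BN 𝔉₅.N ≃* MTM) (c₂ : 𝔉₅.lDeltaModN 𝔉₅.BN ≃* PX),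
      Prop13_i_ii (EnvOfFrobenioid.ofEnvIsoBiTheta 𝔉₅ _ _ _ _ _ _ X F h218 (ContinuousMulEquiv.refl _) h59
        (TemperedFrobenioidData.ofThetaFrobenioid _ 𝔉₅ eB)) := by
  intro 𝔉₅ h59 h218 eB Pj ψ MTM Gc PX _ _ _ i₁ i₂ c₁ c₂
  exact prop13_i_ii_ofEnvIsoBiTheta 𝔉₅ _ _ _ _ _ _ X F h218 _ h59 eB Pj ψ i₁ i₂ c₁ c₂

end EnvIsoBiThetaFamily

end Literature.IUT.HodgeArakelov

end
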